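import Literature.Computability.QuantumComplexity.StabilizerRobustnessFloor
import Literature.Computability.QuantumComplexity.CliffordInverseClosure
import HarnessLib

/-!
# Clifford invariance of the stabilizer fidelity, the stabilizer extent and the robustness of magic

Topic `Literature/Computability/QuantumComplexity` (cell qa-dq, census row DQ-B2, literature-typer
RECORD; no line, no fact, no new definition). The tree's three magic functionals on pure states —
`StabilizerFidelity.stabilizerFidelity` `F(ψ) = sup_{φ ∈ Stab} |⟨φ|ψ⟩|²` and
`StabilizerFidelity.stabilizerExtent` `ξ(ψ) = inf (Σ|cᵢ|)²` (`StabilizerFidelityMagicT.lean`), and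
`StabilizerRobustness.robustnessSet` / `robustness` `ℛ(ψ) = inf Σ|qᵢ|` (`StabilizerRobustnessFloor.lean`)
— are defined as `sSup` / `sInf` of explicit sets indexed by the tree's operational stabilizer states
`stabilizerStates n = {C|0ⁿ⟩ : C ∈ cliffordCircuits n}`. This file proves that for every Clifford circuit
`C ∈ cliffordCircuits n` the DEFINING SETS of `C ψ` and of `ψ` coincide, hence the three functionals are
equal on Clifford-equivalent states — with no nonemptiness / boundedness side condition (equal sets have
equal `sSup` / `sInf`, junk values included). The one tree input that was missing for this
(`NEXT.idea-7.g1.md` §1) is `conjTranspose_mem_cliffordCircuits` (`CliffordInverseClosure.lean`):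
`Cᴴ ∈ cliffordCircuits n`, so `φ ↦ Cφ` is a bijection of `stabilizerStates n` with inverse `φ ↦ Cᴴφ`.

Printed statements formalised: the stabilizer extent and stabilizer fidelity
[cite: BravyiEtAl2019, §2.1 Def. 3 (stabilizer extent) and Def. 4 (stabilizer fidelity)]; "R3 Monotonicity: for all trace-preserving stabilizer channels 𝓔, we have ℛ(𝓔(ρ)) ≤ ℛ(ρ)" — a Clifford
unitary and its inverse are such channels, hence `ℛ` is invariant under Clifford unitaries
[cite: HowardCampbell2017, Suppl. Mat. p. 7, property R3 (monotonicity) and its proof]; Clifford-equivalent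
states [cite: PelegShpilkaVolk2022, §5 (definition of Clifford-equivalent)].

## Contents (all proved; 0 named facts, 0 definitions)

* `dotProduct_mulVec_eq_dotProduct_conjTranspose_mulVec` — `⟨φ|Cψ⟩ = ⟨Cᴴφ|ψ⟩` (adjoint);
* `fidelitySet_mulVec_eq`, **`stabilizerFidelity_mulVec_eq`** — `F(Cψ) = F(ψ)`;
* (private `mulVec_sum_smul`,) `extentSet_mulVec_eq`, **`stabilizerExtent_mulVec_eq`** — `ξ(Cψ) = ξ(ψ)`;
* `vecMulVec_mulVec_star` (`|Cψ⟩⟨Cψ| = C |ψ⟩⟨ψ| Cᴴ`), `conj_sum_smul_vecMulVec`,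
  `robustnessSet_mulVec_eq`, **`robustness_mulVec_eq`** — `ℛ(Cψ) = ℛ(ψ)`.

NOT here: invariance of the stabilizer norm `𝒟` (`StabilizerRobustness.stNorm`), which needs the action
of Clifford circuits on the Pauli OPERATORS (signed permutation of `pauliOp a b`), not available through
this import closure. HONEST FRAMING: three equalities of cost MEASURES under a change of basis by a
Clifford circuit; nothing about their magnitudes, about any simulator or its running time, or about
BQP vs BPP.
-/

namespace Literature.Computability.QuantumComplexity

open _root_.Computability Cryptography Matrix

variable {n : ℕ}

/-! ### The adjoint moves across the inner product -/

/-- `⟨φ|Cψ⟩ = ⟨Cᴴφ|ψ⟩` for any square matrix `C`. [cite: NielsenChuang2010, §2.1.6 (adjoints: (|v⟩, A|w⟩) = (A†|v⟩, |w⟩))] -/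
theorem dotProduct_mulVec_eq_dotProduct_conjTranspose_mulVec (C : Matrix (QReg n) (QReg n) ℂ)
    (φ ψ : QReg n → ℂ) : star φ ⬝ᵥ (C *ᵥ ψ) = star (Cᴴ *ᵥ φ) ⬝ᵥ ψ := by
  rw [Matrix.star_mulVec, Matrix.conjTranspose_conjTranspose, Matrix.dotProduct_mulVec]

/-- A matrix acts linearly on a finite linear combination: `C (Σ cᵢ φᵢ) = Σ cᵢ (C φᵢ)`.
[cite: NielsenChuang2010, §2.1.2 (linear operators)] -/
private theorem mulVec_sum_smul {k : ℕ} (C : Matrix (QReg n) (QReg n) ℂ) (c : Fin k → ℂ)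
    (φ : Fin k → QReg n → ℂ) : C *ᵥ (∑ i, c i • φ i) = ∑ i, c i • (C *ᵥ φ i) := by
  rw [Matrix.mulVec_sum]
  exact Finset.sum_congr rfl fun i _ => Matrix.mulVec_smul _ _ _

namespace StabilizerFidelity

/-! ### Stabilizer fidelity -/

/-- The fidelity set is Clifford-invariant: `{ |⟨φ|Cψ⟩|² : φ ∈ Stab } = { |⟨φ|ψ⟩|² : φ ∈ Stab }`
(`φ ↦ Cᴴφ` and `φ ↦ Cφ` map stabilizer states to stabilizer states).
[cite: BravyiEtAl2019, §2.1 Def. 4 (stabilizer fidelity)] -/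
theorem fidelitySet_mulVec_eq {C : Matrix (QReg n) (QReg n) ℂ} (hC : C ∈ cliffordCircuits n)
    (ψ : QReg n → ℂ) :
    {f : ℝ | ∃ φ ∈ stabilizerStates n, f = ‖star φ ⬝ᵥ (C *ᵥ ψ)‖ ^ 2} =
      {f : ℝ | ∃ φ ∈ stabilizerStates n, f = ‖star φ ⬝ᵥ ψ‖ ^ 2} := by
  ext f
  constructor
  · rintro ⟨φ, hφ, rfl⟩
    exact ⟨Cᴴ *ᵥ φ, mulVec_mem_stabilizerStates (conjTranspose_mem_cliffordCircuits hC) hφ,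
      by rw [dotProduct_mulVec_eq_dotProduct_conjTranspose_mulVec]⟩
  · rintro ⟨φ, hφ, rfl⟩
    refine ⟨C *ᵥ φ, mulVec_mem_stabilizerStates hC hφ, ?_⟩
    rw [dotProduct_mulVec_eq_dotProduct_conjTranspose_mulVec,
      conjTranspose_mulVec_mulVec_of_mem_cliffordCircuits hC]

/-- **The stabilizer fidelity is Clifford-invariant**: `F(Cψ) = F(ψ)` for every Clifford circuit `C`
and every vector `ψ`. [cite: BravyiEtAl2019, §2.1 Def. 4 (stabilizer fidelity)]
[cite: PelegShpilkaVolk2022, §5 (Clifford-equivalent states)] -/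
theorem stabilizerFidelity_mulVec_eq {C : Matrix (QReg n) (QReg n) ℂ} (hC : C ∈ cliffordCircuits n)
    (ψ : QReg n → ℂ) : stabilizerFidelity (C *ᵥ ψ) = stabilizerFidelity ψ := by
  unfold stabilizerFidelity
  rw [fidelitySet_mulVec_eq hC]

/-! ### Stabilizer extent -/

/-- The extent set is Clifford-invariant: the values `(Σ|cᵢ|)²` over stabilizer decompositions of `Cψ`
and of `ψ` are the same set (transport a decomposition with `C`, and back with `Cᴴ`).
[cite: BravyiEtAl2019, §2.1 Def. 3 (stabilizer extent)] -/
theorem extentSet_mulVec_eq {C : Matrix (QReg n) (QReg n) ℂ} (hC : C ∈ cliffordCircuits n)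
    (ψ : QReg n → ℂ) :
    {r : ℝ | ∃ (k : ℕ) (c : Fin k → ℂ) (φ : Fin k → QReg n → ℂ),
        (∀ i, φ i ∈ stabilizerStates n) ∧ C *ᵥ ψ = ∑ i, c i • φ i ∧ r = (∑ i, ‖c i‖) ^ 2} =
      {r : ℝ | ∃ (k : ℕ) (c : Fin k → ℂ) (φ : Fin k → QReg n → ℂ),
        (∀ i, φ i ∈ stabilizerStates n) ∧ ψ = ∑ i, c i • φ i ∧ r = (∑ i, ‖c i‖) ^ 2} := by
  ext r
  constructor
  · rintro ⟨k, c, φ, hφ, hψ, rfl⟩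
    refine ⟨k, c, fun i => Cᴴ *ᵥ φ i,
      fun i => mulVec_mem_stabilizerStates (conjTranspose_mem_cliffordCircuits hC) (hφ i), ?_, rfl⟩
    rw [← mulVec_sum_smul, ← hψ, conjTranspose_mulVec_mulVec_of_mem_cliffordCircuits hC]
  · rintro ⟨k, c, φ, hφ, hψ, rfl⟩
    refine ⟨k, c, fun i => C *ᵥ φ i, fun i => mulVec_mem_stabilizerStates hC (hφ i), ?_, rfl⟩
    rw [← mulVec_sum_smul, ← hψ]

/-- **The stabilizer extent is Clifford-invariant**: `ξ(Cψ) = ξ(ψ)` for every Clifford circuit `C`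
and every vector `ψ`. [cite: BravyiEtAl2019, §2.1 Def. 3 (stabilizer extent)]
[cite: PelegShpilkaVolk2022, §5 (Clifford-equivalent states)] -/
theorem stabilizerExtent_mulVec_eq {C : Matrix (QReg n) (QReg n) ℂ} (hC : C ∈ cliffordCircuits n)
    (ψ : QReg n → ℂ) : stabilizerExtent (C *ᵥ ψ) = stabilizerExtent ψ := by
  unfold stabilizerExtent
  rw [extentSet_mulVec_eq hC]

end StabilizerFidelity

namespace StabilizerRobustness

/-! ### Robustness of magic -/

/-- `|Cψ⟩⟨Cψ| = C |ψ⟩⟨ψ| Cᴴ`. [cite: NielsenChuang2010, §2.1.6 (outer products and adjoints)] -/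
theorem vecMulVec_mulVec_star (C : Matrix (QReg n) (QReg n) ℂ) (ψ : QReg n → ℂ) :
    vecMulVec (C *ᵥ ψ) (star (C *ᵥ ψ)) = C * vecMulVec ψ (star ψ) * Cᴴ := by
  rw [Matrix.mul_vecMulVec, Matrix.vecMulVec_mul, Matrix.star_mulVec]

/-- Conjugating a real pseudomixture of projectors: `C (Σ qᵢ |φᵢ⟩⟨φᵢ|) Cᴴ = Σ qᵢ |Cφᵢ⟩⟨Cφᵢ|`.
[cite: HowardCampbell2017, Suppl. Mat. p. 7, proof of R3 (a stabilizer operation maps stabilizer pseudomixtures to stabilizer pseudomixtures)] -/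
theorem conj_sum_smul_vecMulVec {k : ℕ} (C : Matrix (QReg n) (QReg n) ℂ) (q : Fin k → ℝ)
    (φ : Fin k → QReg n → ℂ) :
    C * (∑ i, (q i : ℂ) • vecMulVec (φ i) (star (φ i))) * Cᴴ =
      ∑ i, (q i : ℂ) • vecMulVec (C *ᵥ φ i) (star (C *ᵥ φ i)) := by
  rw [Finset.mul_sum, Finset.sum_mul]
  refine Finset.sum_congr rfl fun i _ => ?_
  rw [Matrix.mul_smul, Matrix.smul_mul, vecMulVec_mulVec_star]

/-- The robustness set is Clifford-invariant: the `ℓ₁`-costs `Σ|qᵢ|` of stabilizer pseudomixtures of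
`|Cψ⟩⟨Cψ|` and of `|ψ⟩⟨ψ|` form the same set (conjugate by `C`, and back by `Cᴴ`).
[cite: HowardCampbell2017, Suppl. Mat. p. 7, property R3 (monotonicity under trace-preserving stabilizer channels)] -/
theorem robustnessSet_mulVec_eq {C : Matrix (QReg n) (QReg n) ℂ} (hC : C ∈ cliffordCircuits n)
    (ψ : QReg n → ℂ) : robustnessSet (C *ᵥ ψ) = robustnessSet ψ := by
  ext r
  constructor
  · rintro ⟨k, q, φ, hφ, hψ, rfl⟩
    refine ⟨k, q, fun i => Cᴴ *ᵥ φ i,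
      fun i => mulVec_mem_stabilizerStates (conjTranspose_mem_cliffordCircuits hC) (hφ i), ?_, rfl⟩
    have h : vecMulVec ψ (star ψ) = Cᴴ * vecMulVec (C *ᵥ ψ) (star (C *ᵥ ψ)) * Cᴴᴴ := by
      rw [Matrix.conjTranspose_conjTranspose, vecMulVec_mulVec_star, ← Matrix.mul_assoc,
        ← Matrix.mul_assoc, conjTranspose_mul_self_of_mem_cliffordCircuits hC, Matrix.one_mul,
        Matrix.mul_assoc, conjTranspose_mul_self_of_mem_cliffordCircuits hC, Matrix.mul_one]
    rw [h, hψ, conj_sum_smul_vecMulVec]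
  · rintro ⟨k, q, φ, hφ, hψ, rfl⟩
    refine ⟨k, q, fun i => C *ᵥ φ i, fun i => mulVec_mem_stabilizerStates hC (hφ i), ?_, rfl⟩
    rw [vecMulVec_mulVec_star, hψ, conj_sum_smul_vecMulVec]

/-- **The robustness of magic is Clifford-invariant**: `ℛ(Cψ) = ℛ(ψ)` for every Clifford circuit `C`
and every vector `ψ` ("invariant under Clifford unitaries").
[cite: HowardCampbell2017, Suppl. Mat. p. 7, property R3 (monotonicity under trace-preserving stabilizer channels)]
[cite: PelegShpilkaVolk2022, §5 (Clifford-equivalent states)] -/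
theorem robustness_mulVec_eq {C : Matrix (QReg n) (QReg n) ℂ} (hC : C ∈ cliffordCircuits n)
    (ψ : QReg n → ℂ) : robustness (C *ᵥ ψ) = robustness ψ := by
  unfold robustness
  rw [robustnessSet_mulVec_eq hC]

end StabilizerRobustness

end Literature.Computability.QuantumComplexity
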